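import Literature.Computability.Complexity.DiscreteTomographySymmetrization
import Literature.Computability.Complexity.CanonicalCodes
import Literature.Computability.Complexity.ListFoldChecks
import Literature.Computability.Complexity.IntVectorBricks
import Literature.Computability.Complexity.StackBricksStrings
import Literature.Computability.Complexity.ReductionsProofs
import HarnessLib

/-!
# Fischer–Ikenmeyer 2020, Lemma 8: the reduction on codes, and the discharge of
`Tomography.FischerIkenmeyer2020_lemma8`

Sequel of `DiscreteTomographySymmetrization.lean`, which proves Lemma 8 of Fischer–Ikenmeyer
(Comput. Complexity 29 (2020)) at the level of instances: for `|μ| = |ν| = |ρ|`,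
`(μ, ν, ρ) ∈ twoDXRaySet ↔ λ(μ, ν, ρ) ∈ symTwoDXRaySet ↔ λ(μ, ν, ρ) ∈ skewSymTwoDXRaySet`
(`Symmetrization.lam`, `mem_twoDXRaySet_iff_sym`, `mem_twoDXRaySet_iff_skewSym`). Here the map
`(μ, ν, ρ) ↦ λ` is computed ON CODES in polynomial time ("Clearly, this algorithm runs in polynomial
time" is all the source says) and the Karp reductions are assembled, discharging the named fact
`Tomography.FischerIkenmeyer2020_lemma8 : TWODXRAY ≤ₚ SYMTWODXRAY ∧ TWODXRAY ≤ₚ SKEWSYMTWODXRAY`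
(`DiscreteTomography.lean`) as `Tomography.FischerIkenmeyer2020_lemma8_holds`.

No machine is written; everything is brick algebra in the pattern of `KSATReductions.lean`:

* codes: `TWODXRAY` is the `toLanguage` image under `enc3 = encodingComposition.pairBool
  (encodingComposition.pairBool encodingComposition)` (`encodingComposition = unaryEncodingNat.listBool`),
  so a code is `⟨⟨1^{|μ|}, items μ⟩, ⟨⟨1^{|ν|}, items ν⟩, ⟨1^{|ρ|}, items ρ⟩⟩⟩` with
  `items l = frames (l.map unaryEncodeNat)` (`encode_composition`); the total decoders `decL`,
  `dec2`, `dec3` and the canonical re-encodings `cL`, `c2`, `c3` (`CanonCode.canonListFn onesFn`,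
  `CanonCode.canonPairFn`) with `c3 = encode ∘ dec3` (`dec3_spec`);
* the guard: `isCodeFn w = [encode (dec3 w) = w]` (string equality `eqPairFn` with the
  re-encoding; a member of `TWODXRAY` is a code, `encode_dec3_of_mem`) and the length test
  `lensEqFn = [|ν| = |μ| ∧ |ρ| = |μ|]` (equality of the unary headers);
* the output: `buildFn = ⟨1^{9|μ|}, items ρ ++ Z₁ ++ items ν ++ Z₃ ++ items μ ++ Z₂⟩` where
  `Z_k = Brick.zerosFn (1^{k|μ|})` is the item part `(01)^{k|μ|}` of `k|μ|` zeros
  (`IntVectorBricks.lean`, `StackBricksStrings.onesMulFn`); `buildFn_encode`: on a code with fields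
  of a common length this is `encode (λ(μ, ν, ρ))`;
* `toSymFn = iteFn (isCodeFn ∧ lensEqFn) buildFn (const badCode)` with `badCode = encode []`
  (a member of neither target), `toSymFn_mem_FP`, and `karpReducible_of`: ONE map reduces `TWODXRAY`
  to both targets (the instance-level equivalences feed the two cones);
* **`FischerIkenmeyer2020_lemma8_holds`**.

Only the decision form is vendored by the fact; parsimony (the bijection `γ`) is proved in the
companion file but not needed here.

## References

* [FischerIkenmeyer2020] N. Fischer, C. Ikenmeyer, *The computational complexity of plethysm
  coefficients*, Comput. Complexity 29 (2020) 8, arXiv:2002.00788 (held), §3 (encodings), §6,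
  Lemma 8 and its proof.
* [AroraBarak2009] S. Arora, B. Barak, *Computational Complexity: A Modern Approach*, CUP 2009,
  §0.1 (codes of tuples and lists), §1.3 (polynomial time is closed under composition), Def. 2.7.
-/

noncomputable section

namespace Literature.Computability.Complexity

namespace Tomography

open _root_.Computability Brick CanonCode
open scoped Notation

namespace Symmetrization

/-! ### Codes of instances: flat form, total decoders, canonical re-encoding -/

/-- The encoding of 2D-X-RAY instances `⟨μ, ⟨ν, ρ⟩⟩` (that of `TWODXRAY`). [cite: FischerIkenmeyer2020, §3 and §6 (Problem 5)] -/
abbrev enc3 : Encoding (List ℕ × List ℕ × List ℕ) Bool :=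
  encodingComposition.pairBool (encodingComposition.pairBool encodingComposition)

/-- `TWODXRAY` is the language of `enc3`-codes of yes-instances (definitional). [cite: FischerIkenmeyer2020, §6 (Problem 5)] -/
theorem TWODXRAY_eq : TWODXRAY = enc3.toLanguage twoDXRaySet := rfl

/-- The code of a composition, flat: unary length header, then the framed unary entries.
[cite: AroraBarak2009, §0.1] -/
theorem encode_composition (l : List ℕ) :
    encodingComposition.encode l = boolPair (unaryEncodeNat l.length) (frames (l.map unaryEncodeNat)) := by
  show boolPair (unaryEncodeNat l.length) (l.foldr (fun a acc => boolPair (unaryEncodeNat a) acc) []) = _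
  rw [foldr_boolPair_eq]

/-- The code of an instance is the nested pair of the three field codes (definitional). [folklore] -/
theorem enc3_encode (μ ν ρ : List ℕ) :
    enc3.encode (μ, ν, ρ) = boolPair (encodingComposition.encode μ)
      (boolPair (encodingComposition.encode ν) (encodingComposition.encode ρ)) := rfl

/-- The iterated-pair list code `OracleCompose.body` is the framed code `frames`. [folklore] -/
theorem body_eq_frames (t : List (List Bool)) : OracleCompose.body t = frames t := by
  induction t with
  | nil => rfl
  | cons a t ih => rw [OracleCompose.body_cons, ih, frames_cons_eq_boolPair]

/-- The composition read off any string (the total form of `encodingComposition.decode`: as many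
entries as the header is long, each the length of its item). [folklore] -/
def decL (u : List Bool) : List ℕ := NegCNF.decList List.length (boolUnpair u).1.length (boolUnpair u).2

/-- The canonical re-encoding of composition codes (`CanonCode.canonListFn` with the unary item
canonicaliser `onesFn`). [cite: AroraBarak2009, §1.3] -/
def cL : List Bool → List Bool := canonListFn onesFn

/-- `cL ∈ FP`. [cite: AroraBarak2009, §1.3] -/
theorem cL_mem_FP : cL ∈ FP := canonListFn_mem_FP onesFn_mem_FP (a := 0) fun u => by simp

/-- `encodingComposition.decode` is total with value `decL`, and `cL` is its re-encoding. [folklore] -/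
theorem decL_spec (u : List Bool) :
    encodingComposition.decode u = some (decL u) ∧ cL u = encodingComposition.encode (decL u) :=
  canonListFn_eq unaryEncodingNat List.length (fun _ => rfl) (ci := onesFn) (fun _ => rfl) u

/-- The pair of compositions read off any string. [folklore] -/
def dec2 (w : List Bool) : List ℕ × List ℕ := (decL (boolUnpair w).1, decL (boolUnpair w).2)

/-- The canonical re-encoding of pairs of composition codes. [cite: AroraBarak2009, §1.3] -/
def c2 : List Bool → List Bool := canonPairFn cL cL

/-- `c2 ∈ FP`. [cite: AroraBarak2009, §1.3] -/
theorem c2_mem_FP : c2 ∈ FP := canonPairFn_mem_FP cL_mem_FP cL_mem_FP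

/-- The pair decoder is total with value `dec2`, re-encoded by `c2`. [folklore] -/
theorem dec2_spec (w : List Bool) :
    (encodingComposition.pairBool encodingComposition).decode w = some (dec2 w) ∧
      c2 w = (encodingComposition.pairBool encodingComposition).encode (dec2 w) :=
  canonPairFn_eq encodingComposition encodingComposition decL decL (fun u => (decL_spec u).1)
    (fun u => (decL_spec u).1) (fun u => (decL_spec u).2) (fun u => (decL_spec u).2) w

/-- The 2D-X-RAY instance read off any string (the total form of `enc3.decode`). [folklore] -/
def dec3 (w : List Bool) : List ℕ × List ℕ × List ℕ := (decL (boolUnpair w).1, dec2 (boolUnpair w).2)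

/-- The canonical re-encoding of instance codes. [cite: AroraBarak2009, §1.3] -/
def c3 : List Bool → List Bool := canonPairFn cL c2

/-- `c3 ∈ FP`. [cite: AroraBarak2009, §1.3] -/
theorem c3_mem_FP : c3 ∈ FP := canonPairFn_mem_FP cL_mem_FP c2_mem_FP

/-- `enc3.decode` is total with value `dec3`, and `c3 = encode ∘ dec3`. [folklore] -/
theorem dec3_spec (w : List Bool) : enc3.decode w = some (dec3 w) ∧ c3 w = enc3.encode (dec3 w) :=
  canonPairFn_eq encodingComposition (encodingComposition.pairBool encodingComposition) decL dec2
    (fun u => (decL_spec u).1) (fun u => (dec2_spec u).1) (fun u => (decL_spec u).2)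
    (fun u => (dec2_spec u).2) w

/-- The total decoder inverts the encoder. [folklore] -/
theorem dec3_encode (I : List ℕ × List ℕ × List ℕ) : dec3 (enc3.encode I) = I := by
  have h := (dec3_spec (enc3.encode I)).1
  rw [enc3.decode_encode] at h
  exact (Option.some.inj h).symm

/-- A member of a language of instance codes is a code: it re-encodes to itself. [folklore] -/
theorem encode_dec3_of_mem {S : Set (List ℕ × List ℕ × List ℕ)} {x : List Bool}
    (h : x ∈ enc3.toLanguage S) : enc3.encode (dec3 x) = x := by
  obtain ⟨I, -, rfl⟩ := h
  rw [dec3_encode]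

/-! ### The code test and the length test -/

/-- **The code test** `isCodeFn w = [encode (dec3 w) = w]` (string equality of the input with its
canonical re-encoding). [cite: AroraBarak2009, §1.3] -/
def isCodeFn : List Bool → List Bool := eqPairFn ∘ fanoutFn c3 id

/-- `isCodeFn ∈ FP`. [cite: AroraBarak2009, §1.3] -/
theorem isCodeFn_mem_FP : isCodeFn ∈ FP :=
  comp_mem_FP eqPairFn_mem_FP (fanoutFn_mem_FP c3_mem_FP OracleCompose.id_mem_FP)

/-- Value of the code test. [folklore] -/
theorem isCodeFn_apply (w : List Bool) : isCodeFn w = [decide (enc3.encode (dec3 w) = w)] := by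
  rw [isCodeFn, Function.comp_apply, fanoutFn_apply, eqPairFn_boolPair, (dec3_spec w).2]
  rfl

/-- On an instance code: the unary header `1^{|μ|}` of the first field. [folklore] -/
def hμF : List Bool → List Bool := fstF ∘ fstF
/-- On an instance code: the unary header `1^{|ν|}` of the second field. [folklore] -/
def hνF : List Bool → List Bool := fstF ∘ fstF ∘ sndF
/-- On an instance code: the unary header `1^{|ρ|}` of the third field. [folklore] -/
def hρF : List Bool → List Bool := fstF ∘ sndF ∘ sndF
/-- On an instance code: the item part `items μ` of the first field. [folklore] -/
def bμF : List Bool → List Bool := sndF ∘ fstF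
/-- On an instance code: the item part `items ν` of the second field. [folklore] -/
def bνF : List Bool → List Bool := sndF ∘ fstF ∘ sndF
/-- On an instance code: the item part `items ρ` of the third field. [folklore] -/
def bρF : List Bool → List Bool := sndF ∘ sndF ∘ sndF

/-- `hμF ∈ FP`. [folklore] -/
theorem hμF_mem_FP : hμF ∈ FP := comp_mem_FP fstF_mem_FP fstF_mem_FP
/-- `hνF ∈ FP`. [folklore] -/
theorem hνF_mem_FP : hνF ∈ FP := comp_mem_FP fstF_mem_FP (comp_mem_FP fstF_mem_FP sndF_mem_FP)
/-- `hρF ∈ FP`. [folklore] -/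
theorem hρF_mem_FP : hρF ∈ FP := comp_mem_FP fstF_mem_FP (comp_mem_FP sndF_mem_FP sndF_mem_FP)
/-- `bμF ∈ FP`. [folklore] -/
theorem bμF_mem_FP : bμF ∈ FP := comp_mem_FP sndF_mem_FP fstF_mem_FP
/-- `bνF ∈ FP`. [folklore] -/
theorem bνF_mem_FP : bνF ∈ FP := comp_mem_FP sndF_mem_FP (comp_mem_FP fstF_mem_FP sndF_mem_FP)
/-- `bρF ∈ FP`. [folklore] -/
theorem bρF_mem_FP : bρF ∈ FP := comp_mem_FP sndF_mem_FP (comp_mem_FP sndF_mem_FP sndF_mem_FP)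

section values

variable (μ ν ρ : List ℕ)

/-- Value of `hμF` on a code. [folklore] -/
theorem hμF_encode : hμF (enc3.encode (μ, ν, ρ)) = unaryEncodeNat μ.length := by
  simp [hμF, enc3_encode, encode_composition]

/-- Value of `hνF` on a code. [folklore] -/
theorem hνF_encode : hνF (enc3.encode (μ, ν, ρ)) = unaryEncodeNat ν.length := by
  simp [hνF, enc3_encode, encode_composition]

/-- Value of `hρF` on a code. [folklore] -/
theorem hρF_encode : hρF (enc3.encode (μ, ν, ρ)) = unaryEncodeNat ρ.length := by
  simp [hρF, enc3_encode, encode_composition]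

/-- Value of `bμF` on a code. [folklore] -/
theorem bμF_encode : bμF (enc3.encode (μ, ν, ρ)) = frames (μ.map unaryEncodeNat) := by
  simp [bμF, enc3_encode, encode_composition]

/-- Value of `bνF` on a code. [folklore] -/
theorem bνF_encode : bνF (enc3.encode (μ, ν, ρ)) = frames (ν.map unaryEncodeNat) := by
  simp [bνF, enc3_encode, encode_composition]

/-- Value of `bρF` on a code. [folklore] -/
theorem bρF_encode : bρF (enc3.encode (μ, ν, ρ)) = frames (ρ.map unaryEncodeNat) := by
  simp [bρF, enc3_encode, encode_composition]

end values

/-- **The length test** `[|ν| = |μ| ∧ |ρ| = |μ|]`: string equality of the unary headers (an instance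
with fields of different lengths is in no `(ℕ^{[0,r']})³`, hence a no-instance). [cite: FischerIkenmeyer2020, §6 (Problem 5)] -/
def lensEqFn : List Bool → List Bool :=
  andFn (eqPairFn ∘ fanoutFn hμF hνF) (eqPairFn ∘ fanoutFn hμF hρF)

/-- `lensEqFn ∈ FP`. [cite: AroraBarak2009, §1.3] -/
theorem lensEqFn_mem_FP : lensEqFn ∈ FP :=
  andFn_mem_FP (comp_mem_FP eqPairFn_mem_FP (fanoutFn_mem_FP hμF_mem_FP hνF_mem_FP))
    (comp_mem_FP eqPairFn_mem_FP (fanoutFn_mem_FP hμF_mem_FP hρF_mem_FP))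

/-- The length test is one-bit (so the guard can be evaluated on non-codes too; `Brick.oneBit_eqPairFn`,
`ListFoldChecks.lean`). [folklore] -/
theorem oneBit_lensEqFn : OneBit lensEqFn :=
  oneBit_andFn (oneBit_eqPairFn.comp _) (oneBit_eqPairFn.comp _)

/-- **Value of the length test on a code.** [folklore] -/
theorem lensEqFn_encode (μ ν ρ : List ℕ) :
    lensEqFn (enc3.encode (μ, ν, ρ)) = [decide (ν.length = μ.length ∧ ρ.length = μ.length)] := by
  have h1 : (eqPairFn ∘ fanoutFn hμF hνF) (enc3.encode (μ, ν, ρ)) = [decide (ν.length = μ.length)] := by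
    rw [Function.comp_apply, fanoutFn_apply, eqPairFn_boolPair, hμF_encode, hνF_encode]
    simp [OracleCompose.unaryEncodeNat_eq_replicate, eq_comm]
  have h2 : (eqPairFn ∘ fanoutFn hμF hρF) (enc3.encode (μ, ν, ρ)) = [decide (ρ.length = μ.length)] := by
    rw [Function.comp_apply, fanoutFn_apply, eqPairFn_boolPair, hμF_encode, hρF_encode]
    simp [OracleCompose.unaryEncodeNat_eq_replicate, eq_comm]
  rw [lensEqFn, andFn_apply h1 h2, Bool.decide_and]

/-! ### Writing the code of `λ` -/

/-- On an instance code: the item part `(01)^{k|μ|}` of the code of `k|μ|` zeros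
(`Brick.zerosFn` of the unary numeral `1^{k|μ|}`). [cite: AroraBarak2009, §0.1] -/
def zeroItemsF (k : ℕ) : List Bool → List Bool := Brick.zerosFn ∘ onesMulFn k ∘ hμF

/-- `zeroItemsF k ∈ FP`. [cite: AroraBarak2009, §1.3] -/
theorem zeroItemsF_mem_FP (k : ℕ) : zeroItemsF k ∈ FP :=
  comp_mem_FP zerosFn_mem_FP (comp_mem_FP (onesMulFn_mem_FP k) hμF_mem_FP)

/-- Value of `zeroItemsF k` on a code: the framed code of `0^{k|μ|}`. [folklore] -/
theorem zeroItemsF_encode (k : ℕ) (μ ν ρ : List ℕ) :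
    zeroItemsF k (enc3.encode (μ, ν, ρ)) = frames ((List.replicate (k * μ.length) 0).map unaryEncodeNat) := by
  rw [zeroItemsF, Function.comp_apply, Function.comp_apply, hμF_encode, zerosFn_apply, body_eq_frames,
    List.map_replicate]
  simp [onesMulFn, OracleCompose.unaryEncodeNat_eq_replicate]

/-- **The item part of the code of `λ`**: `items ρ ++ Z₁ ++ items ν ++ Z₃ ++ items μ ++ Z₂`
(concatenation of framed codes is the framed code of the concatenation). [cite: FischerIkenmeyer2020, Lemma 8 (proof)] -/
def itemsFn : List Bool → List Bool := fun z =>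
  bρF z ++ (zeroItemsF 1 z ++ (bνF z ++ (zeroItemsF 3 z ++ (bμF z ++ zeroItemsF 2 z))))

/-- `itemsFn ∈ FP` (`append_mem_FP` five times). [cite: AroraBarak2009, §1.3] -/
theorem itemsFn_mem_FP : itemsFn ∈ FP :=
  append_mem_FP bρF_mem_FP (append_mem_FP (zeroItemsF_mem_FP 1) (append_mem_FP bνF_mem_FP
    (append_mem_FP (zeroItemsF_mem_FP 3) (append_mem_FP bμF_mem_FP (zeroItemsF_mem_FP 2)))))

/-- **The code of `λ`**: header `1^{9|μ|}` (`= 1^{|λ|}`), then the items. [cite: FischerIkenmeyer2020, Lemma 8 (proof)] -/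
def buildFn : List Bool → List Bool := fanoutFn (onesMulFn 9 ∘ hμF) itemsFn

/-- `buildFn ∈ FP`. [cite: AroraBarak2009, §1.3] -/
theorem buildFn_mem_FP : buildFn ∈ FP :=
  fanoutFn_mem_FP (comp_mem_FP (onesMulFn_mem_FP 9) hμF_mem_FP) itemsFn_mem_FP

/-- **`buildFn` writes the code of `λ`** on every instance code with fields of a common length.
[cite: FischerIkenmeyer2020, Lemma 8 (proof)] -/
theorem buildFn_encode {μ ν ρ : List ℕ} (hν : ν.length = μ.length) (hρ : ρ.length = μ.length) :
    buildFn (enc3.encode (μ, ν, ρ)) = encodingComposition.encode (lam μ ν ρ) := by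
  rw [buildFn, fanoutFn_apply, encode_composition, length_lam hν hρ, Function.comp_apply, hμF_encode]
  congr 1
  · simp [onesMulFn, OracleCompose.unaryEncodeNat_eq_replicate]
  · simp only [itemsFn, bρF_encode, bνF_encode, bμF_encode, zeroItemsF_encode, lam, List.map_append, frames_append,
      Nat.one_mul]

/-! ### The reduction -/

/-- A fixed member of neither target: the code of the empty composition (no `ℕ^{[0,r]}` contains
it). [cite: FischerIkenmeyer2020, §6 (Problem 7)] -/
def badCode : List Bool := encodingComposition.encode ([] : List ℕ)

/-- `[]` is not a yes-instance of SYMMETRIC-2D-X-RAY. [cite: FischerIkenmeyer2020, §6 (Problem 7)] -/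
theorem nil_not_mem_symTwoDXRaySet : ([] : List ℕ) ∉ symTwoDXRaySet := by
  rintro ⟨r, hr, -⟩
  simp at hr

/-- `[]` is not a yes-instance of SKEW-SYMMETRIC-2D-X-RAY. [cite: FischerIkenmeyer2020, §6 (Problem 7)] -/
theorem nil_not_mem_skewSymTwoDXRaySet : ([] : List ℕ) ∉ skewSymTwoDXRaySet := by
  rintro ⟨r, hr, -⟩
  simp at hr

/-- **The reduction of Lemma 8 on codes**: an instance code with fields of a common length goes to
the code of `λ`, every other string to `badCode`. [cite: FischerIkenmeyer2020, Lemma 8] -/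
def toSymFn : List Bool → List Bool := iteFn (andFn isCodeFn lensEqFn) buildFn fun _ => badCode

/-- **`toSymFn ∈ FP`** ("Clearly, this algorithm runs in polynomial time"). [cite: FischerIkenmeyer2020, Lemma 8] -/
theorem toSymFn_mem_FP : toSymFn ∈ FP :=
  iteFn_mem_FP (andFn_mem_FP isCodeFn_mem_FP lensEqFn_mem_FP) buildFn_mem_FP (const_mem_FP _)

/-- Value of `toSymFn` on a code. [cite: FischerIkenmeyer2020, Lemma 8 (proof)] -/
theorem toSymFn_encode (μ ν ρ : List ℕ) :
    toSymFn (enc3.encode (μ, ν, ρ)) =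
      if ν.length = μ.length ∧ ρ.length = μ.length then encodingComposition.encode (lam μ ν ρ)
      else badCode := by
  have hc : isCodeFn (enc3.encode (μ, ν, ρ)) = [true] := by
    rw [isCodeFn_apply, dec3_encode]; simp
  rw [toSymFn, iteFn_apply (andFn_apply hc (lensEqFn_encode μ ν ρ)), Bool.true_and]
  by_cases h : ν.length = μ.length ∧ ρ.length = μ.length
  · rw [decide_eq_true h, if_pos rfl, if_pos h, buildFn_encode h.1 h.2]
  · rw [decide_eq_false h, if_neg h]; rfl

/-- Value of `toSymFn` on a non-code. [folklore] -/
theorem toSymFn_of_not_code {x : List Bool} (hx : enc3.encode (dec3 x) ≠ x) : toSymFn x = badCode := by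
  have hc : isCodeFn x = [false] := by rw [isCodeFn_apply]; simp [hx]
  obtain ⟨b, hb⟩ := oneBit_lensEqFn x
  rw [toSymFn, iteFn_apply (andFn_apply hc hb)]
  rfl

/-- **Lemma 8, both cones at once**: `toSymFn` reduces `TWODXRAY` to the language of any set `T` of
compositions that misses `[]` and contains `λ(μ, ν, ρ)` exactly when `(μ, ν, ρ)` (fields of a common
length) is a yes-instance of 2D-X-RAY. [cite: FischerIkenmeyer2020, Lemma 8] -/
theorem karpReducible_of (T : Set (List ℕ)) (hnil : ([] : List ℕ) ∉ T)
    (hT : ∀ μ ν ρ : List ℕ, ν.length = μ.length → ρ.length = μ.length →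
      ((μ, ν, ρ) ∈ twoDXRaySet ↔ lam μ ν ρ ∈ T)) :
    TWODXRAY ≤ₚ encodingComposition.toLanguage T := by
  refine ⟨toSymFn, toSymFn_mem_FP, fun x => ?_⟩
  show x ∈ enc3.toLanguage twoDXRaySet ↔ toSymFn x ∈ encodingComposition.toLanguage T
  by_cases hx : enc3.encode (dec3 x) = x
  · rcases e : dec3 x with ⟨μ, ν, ρ⟩
    rw [e] at hx
    rw [← hx, toSymFn_encode, Encoding.mem_toLanguage_iff]
    by_cases hl : ν.length = μ.length ∧ ρ.length = μ.length
    · rw [if_pos hl, Encoding.mem_toLanguage_iff]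
      exact hT μ ν ρ hl.1 hl.2
    · rw [if_neg hl, badCode, Encoding.mem_toLanguage_iff]
      refine ⟨fun h => ?_, fun h => (hnil h).elim⟩
      obtain ⟨r, h1, h2, h3, -⟩ := h
      exact (hl ⟨h2.trans h1.symm, h3.trans h1.symm⟩).elim
  · rw [toSymFn_of_not_code hx, badCode, Encoding.mem_toLanguage_iff]
    exact ⟨fun h => (hx (encode_dec3_of_mem h)).elim, fun h => (hnil h).elim⟩

end Symmetrization

/-- **Discharge of `FischerIkenmeyer2020_lemma8`** (Fischer–Ikenmeyer 2020, Lemma 8: "There exist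
parsimonious polynomial-time reductions from 2D-X-RAY to SYMMETRIC-2D-X-RAY and to
SKEW-SYMMETRIC-2D-X-RAY"), decision form: the polynomial-time map `Symmetrization.toSymFn` together
with the instance-level equivalences `Symmetrization.mem_twoDXRaySet_iff_sym` /
`mem_twoDXRaySet_iff_skewSym` (`DiscreteTomographySymmetrization.lean`). [cite: FischerIkenmeyer2020, Lemma 8] -/
theorem FischerIkenmeyer2020_lemma8_holds : FischerIkenmeyer2020_lemma8 :=
  ⟨Symmetrization.karpReducible_of symTwoDXRaySet Symmetrization.nil_not_mem_symTwoDXRaySet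
      fun _ _ _ hν hρ => Symmetrization.mem_twoDXRaySet_iff_sym hν hρ,
    Symmetrization.karpReducible_of skewSymTwoDXRaySet Symmetrization.nil_not_mem_skewSymTwoDXRaySet
      fun _ _ _ hν hρ => Symmetrization.mem_twoDXRaySet_iff_skewSym hν hρ⟩

end Tomography

end Literature.Computability.Complexity

end
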